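import Summits.MatrixMultiplication.OmegaCensus.SmallFormats.InvertiblePointDefectFootprint
import Mathlib.LinearAlgebra.Dual.Lemmas
import Mathlib.LinearAlgebra.FiniteDimensional.Lemmas
import HarnessLib

/-!
# ω-census family (a): existence of the dual family in the `d`-defect footprint law

Cell `pub-omega` (unit `pub-omega-tensor-g27`), topic `Summits/MatrixMultiplication/OmegaCensus` (sub-folder `SmallFormats`).
Framing (verbatim): lottery ticket; floor = certified bounds/negative ranges. HONEST FRAMING: a linear-algebra complement to
`InvertiblePointDefectFootprint` (p544336): that file derives the footprint and transport identities for ANY dual family `W'` of the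
functionals `γ_s = f_s(1) g_s`, `s ∈ O ∖ D`; this file records that such a family EXISTS (and is linearly independent) as soon as those
`m·n` functionals are linearly independent — the generic choice of the removed set `D` at an invertible point with `|O| = m·n + d` —
and that at `X₀ = 1` the `γ_s`, `s ∈ O`, always SPAN the dual space (so an admissible `D` exists). Elementary; nothing on `ω`.
-/

namespace Summit.MatrixMultiplication.OmegaCensus.SmallFormats

open Module Matrix Literature.Computability.AlgebraicComplexity

variable {k : Type*} [Field k] {m n : ℕ} {ι : Type*} [Fintype ι] [DecidableEq ι]

/-- **A dual family exists.** If `m·n` linear functionals `γ_j`, `j ∈ S`, on `k^{m×n}` are linearly independent, there are vectors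
`W'_j` with `γ_s(W'_j) = δ_{sj}` (`s, j ∈ S`), and they are linearly independent (the dual basis, transported through `V ≃ V**`). -/
theorem exists_dualFamily (S : Finset ι) (γ : ι → Module.Dual k (Matrix (Fin m) (Fin n) k))
    (hli : LinearIndependent k (fun j : S => γ j)) (hcard : S.card = m * n) :
    ∃ W' : ι → Matrix (Fin m) (Fin n) k, (∀ s ∈ S, ∀ j ∈ S, γ s (W' j) = if s = j then 1 else 0) ∧
      LinearIndependent k (fun j : S => W' j) := by
  classical
  set V := Matrix (Fin m) (Fin n) k
  have hcard' : Fintype.card S = finrank k (Module.Dual k V) := by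
    rw [Fintype.card_coe, hcard, Subspace.dual_finrank_eq, finrank_matrix_fin]
  let b : Basis S k (Module.Dual k V) := basisOfLinearIndependentOfCardEqFinrank' (fun j : S => γ j) hli hcard'
  have hb : ∀ j : S, b j = γ j := fun j => by
    simp only [b, coe_basisOfLinearIndependentOfCardEqFinrank']
  let e := (Module.evalEquiv k V).symm
  let W' : ι → V := fun j => if h : j ∈ S then e (b.dualBasis ⟨j, h⟩) else 0
  refine ⟨W', fun s hs j hj => ?_, ?_⟩
  · have : W' j = e (b.dualBasis ⟨j, hj⟩) := dif_pos hj
    rw [this, ← hb ⟨s, hs⟩]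
    change (b ⟨s, hs⟩) ((Module.evalEquiv k V).symm (b.dualBasis ⟨j, hj⟩)) = _
    rw [Module.apply_evalEquiv_symm_apply, Basis.dualBasis_apply_self]
    simp only [Subtype.mk.injEq]
  · have hW : (fun j : S => W' j) = fun j : S => e (b.dualBasis j) := by
      funext j; exact dif_pos j.2
    rw [hW]
    exact (b.dualBasis.map e).linearIndependent

section Span

variable (β : BilinComp (mulBilin k m m n) ι) (O : Finset ι)

omit [DecidableEq ι] in
/-- **The `γ_s` span the dual space at `X₀ = 1`.** Every functional `φ` on `k^{m×n}` equals `Σ_{s∈O} φ(W_s)·γ_s` with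
`γ_s = f_s(1)·g_s` (apply `φ` to `Y = Σ_s γ_s(Y) W_s`). -/
theorem dual_eq_sum_off_one (hO : ∀ i, i ∉ O → β.f i 1 = 0) (φ : Module.Dual k (Matrix (Fin m) (Fin n) k)) :
    φ = ∑ s ∈ O, φ (β.w s) • (β.f s 1 • β.g s) := by
  ext Y
  have h := mul_eq_sum_off β 1 O hO Y
  rw [Matrix.one_mul] at h
  conv_lhs => rw [h]
  simp only [map_sum, map_smul, smul_eq_mul, LinearMap.coe_sum, Finset.sum_apply, LinearMap.smul_apply]
  exact Finset.sum_congr rfl fun s _ => by ring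

omit [DecidableEq ι] in
/-- Hence the `γ_s`, `s ∈ O`, span the whole dual space. -/
theorem span_gamma_eq_top (hO : ∀ i, i ∉ O → β.f i 1 = 0) :
    Submodule.span k (Set.range fun s : O => β.f s 1 • β.g s) = ⊤ := by
  rw [eq_top_iff]
  intro φ _
  rw [dual_eq_sum_off_one β O hO φ]
  refine Submodule.sum_mem _ fun s hs => Submodule.smul_mem _ _ (Submodule.subset_span ⟨⟨s, hs⟩, rfl⟩)

end Span

section OmegaLaw

variable (β : BilinComp (mulBilin k m m n) ι) (O D : Finset ι)

/-- **The `d`-defect ω-law** (the filter of the near/defect ω-engines, now for every `d`): for a dual family `W'` of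
`(γ_s)_{s∈O∖D}` and every functional `ω` killing the outputs `W_t`, `t ∉ O`, and every `j ∈ O ∖ D`, `X`:
`ω(X·W'_j) − c_j(X)·ω(W'_j) = Σ_{k∈D} (c_k(X) − c_j(X))·γ_k(W'_j)·ω(W_k)` — the functional `X ↦ ω(X W'_j) − c_j(X) ω(W'_j)`
is a combination of the `d` functionals `c_k − c_j` with coefficients `γ_k(W'_j)·ω(W_k)` whose second factor does not depend
on `j`. (Apply `ω` to `defectBasis_footprint_eq`.) -/
theorem defect_omega_law (hO : ∀ i, i ∉ O → β.f i 1 = 0) (hO' : ∀ i ∈ O, β.f i 1 ≠ 0) (hD : D ⊆ O)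
    (W' : ι → Matrix (Fin m) (Fin n) k)
    (hdual : ∀ s ∈ O \ D, ∀ j ∈ O \ D, β.f s 1 * β.g s (W' j) = if s = j then 1 else 0)
    (ω : Module.Dual k (Matrix (Fin m) (Fin n) k)) (hω : ∀ t, t ∉ O → ω (β.w t) = 0) {j : ι} (hj : j ∈ O \ D)
    (X : Matrix (Fin m) (Fin m) k) :
    ω (X * W' j) - (β.f j X * (β.f j 1)⁻¹) * ω (W' j) =
      ∑ l ∈ D, (β.f l X * (β.f l 1)⁻¹ - β.f j X * (β.f j 1)⁻¹) * (β.f l 1 * β.g l (W' j)) * ω (β.w l) := by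
  classical
  have h := congrArg ω (defectBasis_footprint_eq β O D hO hO' hD W' hdual hj X)
  rw [map_sub, map_smul, smul_eq_mul, map_add, map_sum, map_sum] at h
  rw [h]
  have hZ : ∑ t ∈ Finset.univ \ O, ω ((β.f t X * β.g t (W' j)) • β.w t) = 0 :=
    Finset.sum_eq_zero fun t ht => by
      rw [map_smul, smul_eq_mul, hω t (Finset.mem_sdiff.mp ht).2, mul_zero]
  rw [hZ, add_zero]
  exact Finset.sum_congr rfl fun l _ => by rw [map_smul, smul_eq_mul]

end OmegaLaw

end Summit.MatrixMultiplication.OmegaCensus.SmallFormats
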